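import Summits.BirchSwinnertonDyer.BirchSwinnertonDyer.Theorems.SylvesterTwoHeegnerIndexCoupledDescentAtTwo
import Literature.NumberTheory.EllipticCurves.SelmerProofs
import Literature.NumberTheory.EllipticCurves.ShaRestrictionJZeroDescent
import Literature.NumberTheory.EllipticCurves.BSDSelmerCMPConverseRankOneProofs
import HarnessLib

/-!
# From THEOREM K2's Selmer form to the stub currency `#Ш(X/ℚ)[p^∞] = 1`

Second helper (planner word pending) after `Theorems/SylvesterTwoHeegnerIndexCoupledDescentAtTwo.lean`
(THEOREM K2's deduction, Selmer form: `Sel_p(A_K/K) = ⊥`, `Sel_p(B_K/K) ≤ closure {δY, w δY}`)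
toward crux `UpperOffV0HSYPlus` (stmt-BirchSwinnertonDyer-19804), VARIANT K stub
`stub_firstLayerFour` (conclusion `Nat.card (primaryComponent X.sha 2) = 1` for the ℚ-models
`X ∈ {A, B}` of the HSY pair). The COROLLARY of memo two §57.4 («hence `Ш(E_{3p²})[2^∞] = 0`,
`Ш(E_p)[2^∞] = 0`»), kernel-checked from tree theorems only:

* `natCard_primaryComponent_sha_eq_one_of_selmerGroup_le_ker` — over any number field: if
  `Sel_p(E/K)` dies in `H¹(K, E)` then `#Ш(E/K)[p^∞] = 1` (Silverman X.4.2(a) `Sel ↠ Ш[p]`, tree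
  `map_torsionH1ToH1_selmerGroup_holds`; a `p`-primary group without `p`-torsion is trivial, tree
  `primaryComponent_sha_eq_bot_of_inf_torsionBy_eq_bot`); the cases `Sel = ⊥` (curve `A`) and
  `Sel ≤ closure {δY, w δY}` with `w` lying over an endomorphism of `H¹(K, E)` (curve `B`; the
  Kummer class of a point dies in `H¹(K, E)`, tree `torsionH1ToH1_kummerMapTorsion`).
* `natCard_primaryComponent_sha_rat_eq_one_of_…` — descent to the ℚ-models `C • X = ⟨0,0,0,0,b⟩`
  along `K ∋ ω`, `[K : ℚ] = 2` (k-ty1 p608170 `JZero.natCard_primaryComponent_sha_eq_one_of_variableChange`).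

Nothing is asserted; no item closed; no label moves; BSD not claimed. Sources: Silverman AEC X.4.2;
Gross 1991 §2 (2.2); memo two §57.1 (Lemma K0) / §57.4 (Corollary).
-/

set_option linter.dupNamespace false -- Summits modules are `Summit.<Summit>.<Problem>…` by design

noncomputable section

open scoped Classical
open WeierstrassCurve NumberField IsDedekindDomain

namespace Summit.BirchSwinnertonDyer.BirchSwinnertonDyer.Theorems.SylvesterTwoCoupledDescentShaCurrency

open Literature.NumberTheory.EllipticCurves

section OverK

variable {K : Type} [Field K] [NumberField K] (W : WeierstrassCurve K) [W.IsElliptic]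

/-- **If `Sel_p(E/K)` dies in `H¹(K, E)` then `Ш(E/K)[p^∞] = 0`** (as `Nat.card = 1`): the image
of `Sel_p` in `H¹(K, E)` is `Ш(E/K) ∩ H¹(K, E)[p]` (Silverman X.4.2(a), tree
`map_torsionH1ToH1_selmerGroup_holds`), so `Ш[p] = 0`, and a `p`-primary group with no `p`-torsion
is trivial (tree `primaryComponent_sha_eq_bot_of_inf_torsionBy_eq_bot`). -/
theorem natCard_primaryComponent_sha_eq_one_of_selmerGroup_le_ker (p : ℕ) [hp : Fact p.Prime]
    (hSel : selmerGroup W p ≤ (torsionH1ToH1 W p).ker) :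
    Nat.card (AddCommGroup.primaryComponent W.sha p) = 1 := by
  have hn : (p : ℤ) ≠ 0 := by exact_mod_cast hp.out.ne_zero
  have hmap := WeierstrassCurve.map_torsionH1ToH1_selmerGroup_holds W hn
  have hbot : (W.sha ⊓ AddSubgroup.torsionBy W.galH1 (p : ℤ) : AddSubgroup W.galH1) = ⊥ := by
    rw [← hmap, eq_bot_iff]
    rintro _ ⟨s, hs, rfl⟩
    exact (AddSubgroup.mem_bot).mpr (hSel hs)
  rw [AddSubgroup.card_eq_one]
  exact primaryComponent_sha_eq_bot_of_inf_torsionBy_eq_bot W p hbot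

/-- **Curve `A` of the coupled pair: `Sel_p(A_K/K) = ⊥ ⇒ #Ш(A_K/K)[p^∞] = 1`.** -/
theorem natCard_primaryComponent_sha_eq_one_of_selmerGroup_eq_bot (p : ℕ) [Fact p.Prime]
    (hSel : selmerGroup W p = ⊥) : Nat.card (AddCommGroup.primaryComponent W.sha p) = 1 :=
  natCard_primaryComponent_sha_eq_one_of_selmerGroup_le_ker W p (hSel ▸ bot_le)

end OverK

section CurveB

variable {K : Type} [Field K] [NumberField K] (B : WeierstrassCurve ℚ)
  [(B.baseChange K).IsElliptic]

/-- **Curve `B` of the coupled pair: `Sel_p(B_K/K) ≤ closure {δY, w δY} ⇒ #Ш(B_K/K)[p^∞] = 1`,**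
for any operator `w` on `H¹(K, B_K[p])` lying over an additive endomorphism `g` of `H¹(K, B_K)`
(`torsionH1ToH1 ∘ w = g ∘ torsionH1ToH1`; for the CM operator `w = [ω]` of
`JZero.exists_cm_operator_galH1Torsion`, `g = galH1Map [ζ]`): the Kummer class `δY` dies in
`H¹(K, B_K)` (tree `torsionH1ToH1_kummerMapTorsion`), hence so does `w δY = g 0`, so `Sel_p` dies
there and `natCard_primaryComponent_sha_eq_one_of_selmerGroup_le_ker` applies. -/
theorem natCard_primaryComponent_sha_eq_one_of_selmerGroup_le_closure {p : ℕ} [Fact p.Prime]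
    (hp : p.Prime) (Y : (B.baseChange K).toAffine.Point)
    (w : galH1Torsion (B.baseChange K) p →+ galH1Torsion (B.baseChange K) p)
    (g : (B.baseChange K).galH1 →+ (B.baseChange K).galH1)
    (hw : ∀ c, torsionH1ToH1 (B.baseChange K) p (w c) = g (torsionH1ToH1 (B.baseChange K) p c))
    (hSel : selmerGroup (B.baseChange K) p ≤
      AddSubgroup.closure {kummerClassOfPoint B K hp Y, w (kummerClassOfPoint B K hp Y)}) :
    Nat.card (AddCommGroup.primaryComponent (B.baseChange K).sha p) = 1 := by
  refine natCard_primaryComponent_sha_eq_one_of_selmerGroup_le_ker (B.baseChange K) p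
    (hSel.trans ((AddSubgroup.closure_le _).mpr ?_))
  have hy : torsionH1ToH1 (B.baseChange K) p (kummerClassOfPoint B K hp Y) = 0 :=
    torsionH1ToH1_kummerMapTorsion (B.baseChange K) (p : ℤ) _ Y
  rintro c (rfl | rfl)
  · exact hy
  · change torsionH1ToH1 (B.baseChange K) p (w (kummerClassOfPoint B K hp Y)) = 0
    rw [hw, hy, map_zero]

end CurveB

section Rat

variable (K : Type) [Field K] [NumberField K]

/-- **Descent to the ℚ-models (stub currency).** For a ℚ-model `X` with `C • X = ⟨0,0,0,0,b⟩`
(`cubeSumCurve n = ⟨0,0,0,0,−432n²⟩` by `rfl`), a number field `K ∋ ω` with `ω² + ω + 1 = 0`,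
`[K : ℚ] = 2`, and a prime `p`: if `Sel_p(⟨0,0,0,0,b⟩_K/K)` dies in `H¹(K, E)` then
`#Ш(X/ℚ)[p^∞] = 1` (k-ty1 p608170 `JZero.natCard_primaryComponent_sha_eq_one_of_variableChange`:
`Ш(X/ℚ) ↪ Ш(X_K/K)` for `j = 0` short models along `ℚ(ω)/ℚ`). -/
theorem natCard_primaryComponent_sha_rat_eq_one_of_selmerGroup_le_ker {X : WeierstrassCurve ℚ}
    [X.IsElliptic] {b : ℚ} {C : VariableChange ℚ} (hC : C • X = ⟨0, 0, 0, 0, b⟩)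
    [((⟨0, 0, 0, 0, b⟩ : WeierstrassCurve ℚ).baseChange K).IsElliptic]
    {ω : K} (hω : ω ^ 2 + ω + 1 = 0) (h2 : Module.finrank ℚ K = 2) (p : ℕ) [Fact p.Prime]
    (hSel : selmerGroup ((⟨0, 0, 0, 0, b⟩ : WeierstrassCurve ℚ).baseChange K) p ≤
      (torsionH1ToH1 ((⟨0, 0, 0, 0, b⟩ : WeierstrassCurve ℚ).baseChange K) p).ker) :
    Nat.card (AddCommGroup.primaryComponent X.sha p) = 1 :=
  JZero.natCard_primaryComponent_sha_eq_one_of_variableChange K hC hω h2 p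
    (natCard_primaryComponent_sha_eq_one_of_selmerGroup_le_ker _ p hSel)

end Rat

/-! ## Composition with THEOREM K2's deduction: the stub currency for the pair -/

section Pair

open Summit.BirchSwinnertonDyer.BirchSwinnertonDyer.Theorems.SylvesterTwoCoupledDescentAtTwo

variable (K : Type) [Field K] [NumberField K]

/-- **THEOREM K2 (Selmer form) ⇒ the stub currency for the pair.** Short `j = 0` models
`A₀ = ⟨0,0,0,0,b_A⟩`, `B₀ = ⟨0,0,0,0,b_B⟩` over `ℚ` (HSY pair: `b_A = −432·9p⁴`, `b_B = −432p²`,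
i.e. `cubeSumCurve (3p²)` / `cubeSumCurve p` by `rfl`), any `ℚ`-models `X_A`, `X_B` of them
(`C • X = …`, the stubs' binders), a number field `K ∋ ω`, `ω² + ω + 1 = 0`, `[K : ℚ] = 2`, a
prime `p`, a point `Y ∈ B₀(K)` and an operator `w` on `H¹(K, B₀,K[p])` lying over an endomorphism
`g` of `H¹(K, B₀,K)` (the CM operator `[ω]`: `JZero.exists_cm_operator_galH1Torsion` (i) with
`g = galH1Map [ζ]`). IF `Sel_p(A₀,K/K) = ⊥` and `Sel_p(B₀,K/K) ≤ closure {δY, w δY}` — the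
conclusion of `selmerGroup_eq_bot_and_le_closure_of_coupledLeaves` (THEOREM K2's deduction from
the leaves (L1)–(L3)) — THEN `#Ш(X_B/ℚ)[p^∞] = 1` and `#Ш(X_A/ℚ)[p^∞] = 1`, the conclusion of
`stub_firstLayerFour/Seven` (at `p = 2`). Memo two §57.4, Corollary. -/
theorem natCard_primaryComponent_sha_eq_one_pair_of_selmer {bA bB : ℚ}
    {XA XB : WeierstrassCurve ℚ} [XA.IsElliptic] [XB.IsElliptic] {CA CB : VariableChange ℚ}
    (hCA : CA • XA = ⟨0, 0, 0, 0, bA⟩) (hCB : CB • XB = ⟨0, 0, 0, 0, bB⟩)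
    [((⟨0, 0, 0, 0, bA⟩ : WeierstrassCurve ℚ).baseChange K).IsElliptic]
    [((⟨0, 0, 0, 0, bB⟩ : WeierstrassCurve ℚ).baseChange K).IsElliptic]
    {ω : K} (hω : ω ^ 2 + ω + 1 = 0) (h2 : Module.finrank ℚ K = 2) {p : ℕ} [Fact p.Prime]
    (hp : p.Prime) (Y : (((⟨0, 0, 0, 0, bB⟩ : WeierstrassCurve ℚ)).baseChange K).toAffine.Point)
    (w : galH1Torsion (((⟨0, 0, 0, 0, bB⟩ : WeierstrassCurve ℚ)).baseChange K) p →+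
      galH1Torsion (((⟨0, 0, 0, 0, bB⟩ : WeierstrassCurve ℚ)).baseChange K) p)
    (g : (((⟨0, 0, 0, 0, bB⟩ : WeierstrassCurve ℚ)).baseChange K).galH1 →+
      (((⟨0, 0, 0, 0, bB⟩ : WeierstrassCurve ℚ)).baseChange K).galH1)
    (hw : ∀ c, torsionH1ToH1 _ p (w c) = g (torsionH1ToH1 _ p c))
    (hK2A : selmerGroup (((⟨0, 0, 0, 0, bA⟩ : WeierstrassCurve ℚ)).baseChange K) p = ⊥)
    (hK2B : selmerGroup (((⟨0, 0, 0, 0, bB⟩ : WeierstrassCurve ℚ)).baseChange K) p ≤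
      AddSubgroup.closure {kummerClassOfPoint _ K hp Y, w (kummerClassOfPoint _ K hp Y)}) :
    Nat.card (AddCommGroup.primaryComponent XB.sha p) = 1 ∧
      Nat.card (AddCommGroup.primaryComponent XA.sha p) = 1 :=
  ⟨JZero.natCard_primaryComponent_sha_eq_one_of_variableChange K hCB hω h2 p
      (natCard_primaryComponent_sha_eq_one_of_selmerGroup_le_closure _ hp Y w g hw hK2B),
    natCard_primaryComponent_sha_rat_eq_one_of_selmerGroup_le_ker K hCA hω h2 p (hK2A ▸ bot_le)⟩

/-- **The stub currency for the pair FROM THE THREE COUPLED LEAVES** (composition of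
`selmerGroup_eq_bot_and_le_closure_of_coupledLeaves` — THEOREM K2's deduction — with
`natCard_primaryComponent_sha_eq_one_pair_of_selmer`): under (L1) coupled classes with the FLIP
criteria, (L2) duality at Kolyvagin primes for `A₀` and `B₀`, (L3) the two Čebotarev clauses — all
for the short models `(A₀, B₀)` over `K` and a point `Y ∈ B₀(K)` not divisible by `p` (the `m = 0`
hypothesis of THEOREM K2; for the stub it is «`ord₂(#Ш_an(B)·#Ш_an(A)) = 0`» read through
Thm B′, a translation NOT done here) — `#Ш(X_B/ℚ)[p^∞] = #Ш(X_A/ℚ)[p^∞] = 1` for all `ℚ`-models.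
At `p = 2`, `K = ℚ(ω)`, `(b_A, b_B) = (−432·9p⁴, −432p²)`, `w = [ω]`, `Kol ℓ ⟺ ℓ ≡ 5 (6) ∧ ℓ ∤ 3p`
this is `stub_firstLayerFour/Seven`'s conclusion modulo the leaves and that translation. -/
theorem natCard_primaryComponent_sha_eq_one_pair_of_coupledLeaves {bA bB : ℚ}
    {XA XB : WeierstrassCurve ℚ} [XA.IsElliptic] [XB.IsElliptic] {CA CB : VariableChange ℚ}
    (hCA : CA • XA = ⟨0, 0, 0, 0, bA⟩) (hCB : CB • XB = ⟨0, 0, 0, 0, bB⟩)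
    [((⟨0, 0, 0, 0, bA⟩ : WeierstrassCurve ℚ).baseChange K).IsElliptic]
    [((⟨0, 0, 0, 0, bB⟩ : WeierstrassCurve ℚ).baseChange K).IsElliptic]
    {ω : K} (hω : ω ^ 2 + ω + 1 = 0) (h2 : Module.finrank ℚ K = 2) {p : ℕ} [Fact p.Prime]
    (hp : p.Prime) (Kol : ℕ → Prop)
    (hKol : ∀ ℓ, Kol ℓ → ℓ.Prime ∧ (Ideal.span {(ℓ : 𝓞 K)}).IsPrime)
    {Y : (((⟨0, 0, 0, 0, bB⟩ : WeierstrassCurve ℚ)).baseChange K).toAffine.Point}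
    (hY : ¬ ∃ Q : (((⟨0, 0, 0, 0, bB⟩ : WeierstrassCurve ℚ)).baseChange K).toAffine.Point,
      p • Q = Y)
    (w : galH1Torsion (((⟨0, 0, 0, 0, bB⟩ : WeierstrassCurve ℚ)).baseChange K) p →+
      galH1Torsion (((⟨0, 0, 0, 0, bB⟩ : WeierstrassCurve ℚ)).baseChange K) p)
    (g : (((⟨0, 0, 0, 0, bB⟩ : WeierstrassCurve ℚ)).baseChange K).galH1 →+
      (((⟨0, 0, 0, 0, bB⟩ : WeierstrassCurve ℚ)).baseChange K).galH1)
    (hw : ∀ c, torsionH1ToH1 _ p (w c) = g (torsionH1ToH1 _ p c))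
    (hL1 : ∃ (cA : ℕ → galH1Torsion (((⟨0, 0, 0, 0, bA⟩ : WeierstrassCurve ℚ)).baseChange K) p)
        (cB : ℕ → galH1Torsion (((⟨0, 0, 0, 0, bB⟩ : WeierstrassCurve ℚ)).baseChange K) p),
      (∀ ℓ, Kol ℓ →
        (∀ v : HeightOneSpectrum (𝓞 K), (ℓ : 𝓞 K) ∉ v.asIdeal →
          cA ℓ ∈ selmerLocalKer (((⟨0, 0, 0, 0, bA⟩ : WeierstrassCurve ℚ)).baseChange K)
            (v.adicCompletion K) p) ∧
        (∀ x : InfinitePlace K,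
          cA ℓ ∈ selmerLocalKer (((⟨0, 0, 0, 0, bA⟩ : WeierstrassCurve ℚ)).baseChange K)
            x.Completion p) ∧
        (∀ v : HeightOneSpectrum (𝓞 K), (ℓ : 𝓞 K) ∈ v.asIdeal →
          (cA ℓ ∈ selmerLocalKer (((⟨0, 0, 0, 0, bA⟩ : WeierstrassCurve ℚ)).baseChange K)
              (v.adicCompletion K) p ↔
            kummerClassOfPoint _ K hp Y ∈ (((⟨0, 0, 0, 0, bB⟩ : WeierstrassCurve ℚ)).baseChange
              K).torsionLocalKer (v.adicCompletion K) p))) ∧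
      (∀ ℓ ℓ', Kol ℓ → Kol ℓ' → ℓ ≠ ℓ' →
        (∀ v : HeightOneSpectrum (𝓞 K), (ℓ : 𝓞 K) ∉ v.asIdeal → (ℓ' : 𝓞 K) ∉ v.asIdeal →
          cB (ℓ * ℓ') ∈ selmerLocalKer (((⟨0, 0, 0, 0, bB⟩ : WeierstrassCurve ℚ)).baseChange K)
            (v.adicCompletion K) p) ∧
        (∀ x : InfinitePlace K,
          cB (ℓ * ℓ') ∈ selmerLocalKer (((⟨0, 0, 0, 0, bB⟩ : WeierstrassCurve ℚ)).baseChange K)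
            x.Completion p) ∧
        (∀ v : HeightOneSpectrum (𝓞 K), (ℓ : 𝓞 K) ∈ v.asIdeal →
          (cB (ℓ * ℓ') ∈ selmerLocalKer (((⟨0, 0, 0, 0, bB⟩ : WeierstrassCurve ℚ)).baseChange K)
              (v.adicCompletion K) p ↔
            cA ℓ' ∈ (((⟨0, 0, 0, 0, bA⟩ : WeierstrassCurve ℚ)).baseChange K).torsionLocalKer
              (v.adicCompletion K) p))))
    (hL2A : ∀ ℓ, Kol ℓ →
      ∀ d : galH1Torsion (((⟨0, 0, 0, 0, bA⟩ : WeierstrassCurve ℚ)).baseChange K) p,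
      (∀ v : HeightOneSpectrum (𝓞 K), (ℓ : 𝓞 K) ∉ v.asIdeal →
        d ∈ selmerLocalKer (((⟨0, 0, 0, 0, bA⟩ : WeierstrassCurve ℚ)).baseChange K)
          (v.adicCompletion K) p) →
      (∀ x : InfinitePlace K,
        d ∈ selmerLocalKer (((⟨0, 0, 0, 0, bA⟩ : WeierstrassCurve ℚ)).baseChange K)
          x.Completion p) →
      ∀ v : HeightOneSpectrum (𝓞 K), (ℓ : 𝓞 K) ∈ v.asIdeal →
        d ∉ selmerLocalKer (((⟨0, 0, 0, 0, bA⟩ : WeierstrassCurve ℚ)).baseChange K)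
          (v.adicCompletion K) p →
        ∀ s ∈ selmerGroup (((⟨0, 0, 0, 0, bA⟩ : WeierstrassCurve ℚ)).baseChange K) p,
          s ∈ (((⟨0, 0, 0, 0, bA⟩ : WeierstrassCurve ℚ)).baseChange K).torsionLocalKer
            (v.adicCompletion K) p)
    (hL2B : ∀ ℓ, Kol ℓ →
      ∀ d : galH1Torsion (((⟨0, 0, 0, 0, bB⟩ : WeierstrassCurve ℚ)).baseChange K) p,
      (∀ v : HeightOneSpectrum (𝓞 K), (ℓ : 𝓞 K) ∉ v.asIdeal →
        d ∈ selmerLocalKer (((⟨0, 0, 0, 0, bB⟩ : WeierstrassCurve ℚ)).baseChange K)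
          (v.adicCompletion K) p) →
      (∀ x : InfinitePlace K,
        d ∈ selmerLocalKer (((⟨0, 0, 0, 0, bB⟩ : WeierstrassCurve ℚ)).baseChange K)
          x.Completion p) →
      ∀ v : HeightOneSpectrum (𝓞 K), (ℓ : 𝓞 K) ∈ v.asIdeal →
        d ∉ selmerLocalKer (((⟨0, 0, 0, 0, bB⟩ : WeierstrassCurve ℚ)).baseChange K)
          (v.adicCompletion K) p →
        ∀ s ∈ selmerGroup (((⟨0, 0, 0, 0, bB⟩ : WeierstrassCurve ℚ)).baseChange K) p,
          s ∈ (((⟨0, 0, 0, 0, bB⟩ : WeierstrassCurve ℚ)).baseChange K).torsionLocalKer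
            (v.adicCompletion K) p)
    (hL3a : ∀ (s : galH1Torsion (((⟨0, 0, 0, 0, bA⟩ : WeierstrassCurve ℚ)).baseChange K) p)
      (t : galH1Torsion (((⟨0, 0, 0, 0, bB⟩ : WeierstrassCurve ℚ)).baseChange K) p),
      Set.Infinite {ℓ : ℕ | Kol ℓ ∧ ∀ v : HeightOneSpectrum (𝓞 K), (ℓ : 𝓞 K) ∈ v.asIdeal →
        (s ≠ 0 → s ∉ (((⟨0, 0, 0, 0, bA⟩ : WeierstrassCurve ℚ)).baseChange K).torsionLocalKer
          (v.adicCompletion K) p) ∧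
        (t ≠ 0 → t ∉ (((⟨0, 0, 0, 0, bB⟩ : WeierstrassCurve ℚ)).baseChange K).torsionLocalKer
          (v.adicCompletion K) p)})
    (hL3b : ∀ s ∈ selmerGroup (((⟨0, 0, 0, 0, bB⟩ : WeierstrassCurve ℚ)).baseChange K) p,
      (¬ ∃ a b : ℤ, s = a • kummerClassOfPoint _ K hp Y + b • w (kummerClassOfPoint _ K hp Y)) →
      ∀ c : galH1Torsion (((⟨0, 0, 0, 0, bA⟩ : WeierstrassCurve ℚ)).baseChange K) p, c ≠ 0 →
      Set.Infinite {ℓ : ℕ | Kol ℓ ∧ ∀ v : HeightOneSpectrum (𝓞 K), (ℓ : 𝓞 K) ∈ v.asIdeal →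
        kummerClassOfPoint _ K hp Y ∈ (((⟨0, 0, 0, 0, bB⟩ : WeierstrassCurve ℚ)).baseChange
          K).torsionLocalKer (v.adicCompletion K) p ∧
        s ∉ (((⟨0, 0, 0, 0, bB⟩ : WeierstrassCurve ℚ)).baseChange K).torsionLocalKer
          (v.adicCompletion K) p ∧
        c ∉ (((⟨0, 0, 0, 0, bA⟩ : WeierstrassCurve ℚ)).baseChange K).torsionLocalKer
          (v.adicCompletion K) p}) :
    Nat.card (AddCommGroup.primaryComponent XB.sha p) = 1 ∧
      Nat.card (AddCommGroup.primaryComponent XA.sha p) = 1 := by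
  obtain ⟨hK2A, hK2B⟩ := selmerGroup_eq_bot_and_le_closure_of_coupledLeaves
    (⟨0, 0, 0, 0, bA⟩ : WeierstrassCurve ℚ) (⟨0, 0, 0, 0, bB⟩ : WeierstrassCurve ℚ) hp Kol hKol hY
    w hL1 hL2A hL2B hL3a hL3b
  exact natCard_primaryComponent_sha_eq_one_pair_of_selmer K hCA hCB hω h2 hp Y w g hw hK2A hK2B

end Pair

end Summit.BirchSwinnertonDyer.BirchSwinnertonDyer.Theorems.SylvesterTwoCoupledDescentShaCurrency

end
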